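import Summits.CriticalPhenomena.PercolationContinuityZ3.Theorems.Transplant.HexShadowRouteData
import Summits.CriticalPhenomena.PercolationContinuityZ3.Theorems.Transplant.TriFilmHexShadow
import HarnessLib

/-!
# Paths in the triangular films `𝕋 × {0..k}`: vertices by (column, layer), self-avoiding paths as vertex lists, lifted planar legs, vertical segments

builds on p205010 (kernel theorem, internal audit signed; external expert review pending) — NOT used in this file.  Lane `prim-bschramm`, seat
`prim-bschramm-p2` (gen 33; class C1b; memo `HOME/bschramm/P2-LATTICES.md` §121); helper file (`--supports stmt-CriticalPhenomena-4575 --as helper`).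
Slab analogue: `Literature/…/SlabGluingRouting` §"Coordinates", "Vertical and lifted pieces", `SPath` — here for `TriFilm.film k` (vertex type `triFilm k ⊆ 𝕋 × ℤ`).
The toolkit the routing template «TriFilmRouteT» is built from:
* §1 `vx k q j` — the vertex over `q ∈ 𝕋` at layer `min j k`; coordinates, injectivity, every vertex is a `vx`, adjacency of two `vx`;
* §2 `FPath k l s t` — `l` is a self-avoiding path of the film from `s` to `t` (vertex list); `single`, `pair`, `reverse`, gluing at a common end vertex
  (`FPath.trans`), the decomposition `l = s :: (l.tail.dropLast ++ [t])`;
* §3 lifted planar legs `lay k j l` and vertical segments `vseg k q a b` as `FPath`s, with their membership lemmas.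
[cite: DuminilCopinSidoraviciusTassion2016, §2.3 (proof of Fact 2: the paths γ_u, γ_v, γ_w)]
-/

noncomputable section

namespace Summit.CriticalPhenomena.PercolationContinuityZ3.Theorems.Transplant

open Literature.Probability.Percolation Literature.Probability.LatticeModels SimpleGraph
open scoped Classical

namespace TriFilm

variable (k : ℕ)

/-! ## §1 Vertices by column and layer -/

/-- The vertex of the film over the column `q ∈ 𝕋` at layer `min j k`. [folklore] -/
def vx (q : Site 2) (j : ℕ) : triFilm k :=
  ⟨(q, ![((min j k : ℕ) : ℤ)]), by rw [mem_triFilm]; simp⟩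

variable {k}

/-- The column of `vx`. [folklore] -/
@[simp] theorem vx_fst (q : Site 2) (j : ℕ) : ((vx k q j : triFilm k) : Site 2 × Site 1).1 = q := rfl

/-- The layer of `vx`. [folklore] -/
theorem vx_snd {j : ℕ} (hj : j ≤ k) (q : Site 2) : ((vx k q j : triFilm k) : Site 2 × Site 1).2 0 = j := by
  simp [vx, min_eq_left hj]

/-- The layer coordinate of `vx`. [folklore] -/
theorem vx_snd_eq {j : ℕ} (hj : j ≤ k) (q : Site 2) : ((vx k q j : triFilm k) : Site 2 × Site 1).2 = ![(j : ℤ)] := by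
  ext i; fin_cases i; simp [vx, min_eq_left hj]

/-- The shadow of `vx` is its column. [folklore] -/
@[simp] theorem sh_vx (q : Site 2) (j : ℕ) : (hexShadow k).sh (vx k q j) = q := rfl

/-- **Injectivity** of `vx` on layers `≤ k`. [folklore] -/
theorem vx_inj {q q' : Site 2} {j j' : ℕ} (hj : j ≤ k) (hj' : j' ≤ k) : vx k q j = vx k q' j' ↔ q = q' ∧ j = j' := by
  constructor
  · intro h
    have h1 := congrArg (fun v : triFilm k => ((v : Site 2 × Site 1).1, (v : Site 2 × Site 1).2 0)) h
    simp only [vx_fst, vx_snd hj, vx_snd hj', Prod.mk.injEq, Nat.cast_inj] at h1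
    exact h1
  · rintro ⟨rfl, rfl⟩; rfl

/-- **Every vertex of the film is a `vx`.** [folklore] -/
theorem exists_eq_vx (v : triFilm k) : ∃ (q : Site 2) (j : ℕ), j ≤ k ∧ v = vx k q j := by
  obtain ⟨⟨q, z⟩, hv⟩ := v
  rw [mem_triFilm] at hv
  change 0 ≤ z 0 ∧ z 0 ≤ k at hv
  refine ⟨q, (z 0).toNat, by omega, Subtype.ext (Prod.ext rfl ?_)⟩
  ext i; fin_cases i
  simp [vx]
  omega

/-- **Adjacency of two `vx`**: a `𝕋`-step inside a layer, or a unit step inside a column. [folklore] -/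
theorem adj_vx_iff {q q' : Site 2} {j j' : ℕ} (hj : j ≤ k) (hj' : j' ≤ k) :
    (film k).Adj (vx k q j) (vx k q' j') ↔ (triGraph.Adj q q' ∧ j = j') ∨ (q = q' ∧ (j' = j + 1 ∨ j = j' + 1)) := by
  change stackedTriangularGraph.Adj (vx k q j : Site 2 × Site 1) (vx k q' j') ↔ _
  rw [stackedTriangularGraph_adj]
  simp only [vx_fst, vx_snd_eq hj, vx_snd_eq hj']
  have hz : (zdGraph 1).Adj ![(j : ℤ)] ![(j' : ℤ)] ↔ (j' = j + 1 ∨ j = j' + 1) := by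
    rw [zdGraph_adj_iff]
    constructor
    · rintro ⟨i, h | h⟩ <;> fin_cases i
      · have := congrFun h 0; simp at this; omega
      · have := congrFun h 0; simp at this; omega
    · rintro (h | h)
      · exact ⟨0, Or.inl (by ext i; fin_cases i; simp; omega)⟩
      · exact ⟨0, Or.inr (by ext i; fin_cases i; simp; omega)⟩
  have he : (![(j : ℤ)] : Site 1) = ![(j' : ℤ)] ↔ j = j' := by
    constructor
    · intro h; have := congrFun h 0; simpa using this
    · rintro rfl; rfl
  rw [hz, he]
  tauto

/-- A planar step inside a layer. [folklore] -/
theorem adj_vx_planar {q q' : Site 2} (h : triGraph.Adj q q') {j : ℕ} (hj : j ≤ k) : (film k).Adj (vx k q j) (vx k q' j) :=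
  (adj_vx_iff hj hj).2 (Or.inl ⟨h, rfl⟩)

/-- A vertical step inside a column. [folklore] -/
theorem adj_vx_succ (q : Site 2) {j : ℕ} (hj : j + 1 ≤ k) : (film k).Adj (vx k q j) (vx k q (j + 1)) :=
  (adj_vx_iff (by omega) hj).2 (Or.inr ⟨rfl, Or.inl rfl⟩)

/-- The centre is adjacent to every point of the inner ring. [folklore] -/
theorem triGraph_adj_zero_of_triNorm {r : Site 2} (hr : triNorm r = 1) : triGraph.Adj 0 r := by
  rw [triGraph_adj_iff_triNorm, sub_zero]; exact hr

/-! ## §2 Self-avoiding paths as vertex lists -/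

/-- **`l` is a self-avoiding path of the film from `s` to `t`** (non-empty, consecutive vertices adjacent, duplicate-free). [folklore] -/
structure FPath (k : ℕ) (l : List (triFilm k)) (s t : triFilm k) : Prop where
  /-- non-empty -/
  ne_nil : l ≠ []
  /-- consecutive vertices adjacent -/
  chain : l.IsChain (fun a b => (film k).Adj a b)
  /-- self-avoiding -/
  nodup : l.Nodup
  /-- starts at `s` -/
  head : l.head? = some s
  /-- ends at `t` -/
  last : l.getLast? = some t

namespace FPath

variable {l l₁ l₂ : List (triFilm k)} {s t m : triFilm k}

/-- The trivial path. [folklore] -/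
theorem single (v : triFilm k) : FPath k [v] v v := ⟨by simp, List.IsChain.singleton _, List.nodup_singleton _, rfl, rfl⟩

/-- A single edge. [folklore] -/
theorem pair {u v : triFilm k} (h : (film k).Adj u v) : FPath k [u, v] u v :=
  ⟨by simp, List.isChain_cons_cons.2 ⟨h, List.IsChain.singleton _⟩, by simp [h.ne], rfl, rfl⟩

/-- The start vertex lies on the path. [folklore] -/
theorem head_mem (h : FPath k l s t) : s ∈ l := List.mem_of_mem_head? h.head

/-- The end vertex lies on the path. [folklore] -/
theorem last_mem (h : FPath k l s t) : t ∈ l := List.mem_of_getLast? h.last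

/-- Reversal. [folklore] -/
theorem reverse (h : FPath k l s t) : FPath k l.reverse t s where
  ne_nil := by simpa using h.ne_nil
  chain := List.isChain_reverse.2 (h.chain.imp fun _ _ hab => hab.symm)
  nodup := List.nodup_reverse.2 h.nodup
  head := by rw [List.head?_reverse]; exact h.last
  last := by rw [List.getLast?_reverse]; exact h.head

/-- **Gluing two paths at a common end vertex** (the second path's other vertices off the first). [folklore] -/
theorem trans (h₁ : FPath k l₁ s m) (h₂ : FPath k l₂ m t) (hdisj : ∀ v ∈ l₂, v ∈ l₁ → v = m) : FPath k (l₁ ++ l₂.tail) s t := by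
  obtain ⟨x, xs, rfl⟩ := List.exists_cons_of_ne_nil h₂.ne_nil
  have hx : x = m := by simpa using h₂.head
  subst hx
  refine ⟨by simp [h₁.ne_nil], ?_, ?_, ?_, ?_⟩
  · rw [List.isChain_append]
    refine ⟨h₁.chain, ?_, ?_⟩
    · have := h₂.chain
      rw [List.isChain_cons] at this
      exact this.2
    · intro a ha b hb
      rw [h₁.last, Option.mem_def, Option.some.injEq] at ha
      subst ha
      have := h₂.chain
      rw [List.isChain_cons] at this
      exact this.1 b hb
  · rw [List.nodup_append]
    refine ⟨h₁.nodup, (List.nodup_cons.1 h₂.nodup).2, fun a ha b hb hab => ?_⟩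
    subst hab
    have := hdisj a (List.mem_cons_of_mem _ hb) ha
    subst this
    exact (List.nodup_cons.1 h₂.nodup).1 hb
  · rw [List.head?_append, h₁.head]; rfl
  · cases xs with
    | nil =>
      have := h₂.last
      simp only [List.getLast?_singleton, Option.some.injEq] at this
      subst this
      simpa using h₁.last
    | cons y ys =>
      have := h₂.last
      rw [List.tail_cons, List.getLast?_append, List.getLast?_cons_cons] at *
      rw [this]; rfl

/-- A path between distinct vertices splits off both ends: `l = s :: (l.tail.dropLast ++ [t])`. [folklore] -/
theorem eq_cons_dropLast_concat (h : FPath k l s t) (hst : s ≠ t) : l = s :: (l.tail.dropLast ++ [t]) := by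
  obtain ⟨x, xs, rfl⟩ := List.exists_cons_of_ne_nil h.ne_nil
  have hx : x = s := by simpa using h.head
  subst hx
  cases xs with
  | nil =>
    have := h.last
    simp only [List.getLast?_singleton, Option.some.injEq] at this
    exact absurd this hst
  | cons y ys =>
    have hl := h.last
    rw [List.getLast?_cons_cons, List.getLast?_eq_some_getLast (List.cons_ne_nil _ _), Option.some.injEq] at hl
    simp only [List.tail_cons, List.cons.injEq, true_and]
    rw [← hl]
    exact (List.dropLast_append_getLast (List.cons_ne_nil y ys)).symm

/-- All vertices of a path other than its start lie in its tail. [folklore] -/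
theorem mem_tail_of_ne (h : FPath k l s t) {v : triFilm k} (hv : v ∈ l) (hne : v ≠ s) : v ∈ l.tail := by
  obtain ⟨x, xs, rfl⟩ := List.exists_cons_of_ne_nil h.ne_nil
  have hx : x = s := by simpa using h.head
  subst hx
  rcases List.mem_cons.1 hv with rfl | hv
  · exact absurd rfl hne
  · exact hv

/-- The tail of a path misses its start. [folklore] -/
theorem not_mem_tail (h : FPath k l s t) : s ∉ l.tail := by
  obtain ⟨x, xs, rfl⟩ := List.exists_cons_of_ne_nil h.ne_nil
  have hx : x = s := by simpa using h.head
  subst hx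
  exact (List.nodup_cons.1 h.nodup).1

end FPath

/-! ## §3 Lifted planar legs and vertical segments -/

/-- The planar list `l` lifted to layer `j`. [folklore] -/
def lay (k : ℕ) (j : ℕ) (l : List (Site 2)) : List (triFilm k) := l.map fun q => vx k q j

/-- Membership in a lifted list. [folklore] -/
theorem mem_lay {j : ℕ} {l : List (Site 2)} {v : triFilm k} : v ∈ lay k j l ↔ ∃ q ∈ l, v = vx k q j := by
  simp only [lay, List.mem_map]
  exact ⟨fun ⟨q, hq, h⟩ => ⟨q, hq, h.symm⟩, fun ⟨q, hq, h⟩ => ⟨q, hq, h.symm⟩⟩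

/-- **A planar self-avoiding `𝕋`-path lifts to a path of the film in any layer.** [folklore] -/
theorem fpath_lay {j : ℕ} (hj : j ≤ k) {l : List (Site 2)} (hne : l ≠ []) (hch : l.IsChain (fun a b => triGraph.Adj a b)) (hnd : l.Nodup) :
    FPath k (lay k j l) (vx k (l.head hne) j) (vx k (l.getLast hne) j) where
  ne_nil := by simpa [lay] using hne
  chain := by
    rw [lay, List.isChain_map]
    exact hch.imp fun a b h => adj_vx_planar h hj
  nodup := by
    rw [lay]
    exact hnd.map fun a b h => ((vx_inj hj hj).1 h).1
  head := by rw [lay, List.head?_map, List.head?_eq_some_head hne]; rfl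
  last := by rw [lay, List.getLast?_map, List.getLast?_eq_some_getLast hne]; rfl

/-- The upward vertical segment `vx q a, vx q (a+1), …, vx q (a+n)`. [folklore] -/
def vup (k : ℕ) (q : Site 2) (a n : ℕ) : List (triFilm k) := (List.range (n + 1)).map fun i => vx k q (a + i)

/-- Membership in an upward segment. [folklore] -/
theorem mem_vup {q : Site 2} {a n : ℕ} {v : triFilm k} : v ∈ vup k q a n ↔ ∃ i, i ≤ n ∧ v = vx k q (a + i) := by
  simp only [vup, List.mem_map, List.mem_range]
  constructor
  · rintro ⟨i, hi, rfl⟩; exact ⟨i, by omega, rfl⟩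
  · rintro ⟨i, hi, rfl⟩; exact ⟨i, by omega, rfl⟩

/-- An upward segment below layer `k` is a path. [folklore] -/
theorem fpath_vup (q : Site 2) {a n : ℕ} (h : a + n ≤ k) : FPath k (vup k q a n) (vx k q a) (vx k q (a + n)) where
  ne_nil := by simp [vup]
  chain := by
    rw [vup, List.isChain_map]
    exact (List.isChain_range_succ _ _).2 fun m hm => by
      rw [show a + m.succ = (a + m) + 1 by omega]
      exact adj_vx_succ q (by omega)
  nodup := by
    rw [vup]
    refine (List.nodup_range).map_on fun i hi i' hi' h' => ?_
    rw [List.mem_range] at hi hi'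
    have := ((vx_inj (by omega) (by omega)).1 h').2
    omega
  head := by rw [vup, List.head?_map, List.range_succ_eq_map]; simp
  last := by
    rw [vup, List.getLast?_map, List.range_succ, List.getLast?_append]; simp

/-- **The vertical segment** from `vx q a` to `vx q b` (upwards or downwards). [folklore] -/
def vseg (k : ℕ) (q : Site 2) (a b : ℕ) : List (triFilm k) := if a ≤ b then vup k q a (b - a) else (vup k q b (a - b)).reverse

/-- Membership in a vertical segment: the vertices `vx q i` with `i` between `a` and `b`. [folklore] -/
theorem mem_vseg {q : Site 2} {a b : ℕ} {v : triFilm k} : v ∈ vseg k q a b ↔ ∃ i, min a b ≤ i ∧ i ≤ max a b ∧ v = vx k q i := by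
  unfold vseg
  split_ifs with h
  · rw [mem_vup]
    constructor
    · rintro ⟨i, hi, rfl⟩; exact ⟨a + i, by omega, by omega, rfl⟩
    · rintro ⟨i, hi1, hi2, rfl⟩; exact ⟨i - a, by omega, by rw [show a + (i - a) = i by omega]⟩
  · rw [List.mem_reverse, mem_vup]
    constructor
    · rintro ⟨i, hi, rfl⟩; exact ⟨b + i, by omega, by omega, rfl⟩
    · rintro ⟨i, hi1, hi2, rfl⟩; exact ⟨i - b, by omega, by rw [show b + (i - b) = i by omega]⟩

/-- **A vertical segment inside the film is a path** from `vx q a` to `vx q b`. [folklore] -/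
theorem fpath_vseg (q : Site 2) {a b : ℕ} (ha : a ≤ k) (hb : b ≤ k) : FPath k (vseg k q a b) (vx k q a) (vx k q b) := by
  unfold vseg
  split_ifs with h
  · have := fpath_vup (k := k) q (a := a) (n := b - a) (by omega)
    rwa [show a + (b - a) = b by omega] at this
  · have := (fpath_vup (k := k) q (a := b) (n := a - b) (by omega)).reverse
    rwa [show b + (a - b) = a by omega] at this

/-- The column of a vertex of a vertical segment. [folklore] -/
theorem fst_of_mem_vseg {q : Site 2} {a b : ℕ} {v : triFilm k} (hv : v ∈ vseg k q a b) : ((v : triFilm k) : Site 2 × Site 1).1 = q := by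
  obtain ⟨i, -, -, rfl⟩ := mem_vseg.1 hv; rfl

/-- The column of a vertex of a lifted list. [folklore] -/
theorem fst_of_mem_lay {j : ℕ} {l : List (Site 2)} {v : triFilm k} (hv : v ∈ lay k j l) : ((v : triFilm k) : Site 2 × Site 1).1 ∈ l := by
  obtain ⟨q, hq, rfl⟩ := mem_lay.1 hv; exact hq

/-- The layer of a vertex of a lifted list. [folklore] -/
theorem snd_of_mem_lay {j : ℕ} (hj : j ≤ k) {l : List (Site 2)} {v : triFilm k} (hv : v ∈ lay k j l) : ((v : triFilm k) : Site 2 × Site 1).2 0 = j := by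
  obtain ⟨q, hq, rfl⟩ := mem_lay.1 hv; exact vx_snd hj q

/-- The layer of a vertex of a vertical segment lies between the ends. [folklore] -/
theorem snd_of_mem_vseg {q : Site 2} {a b : ℕ} (ha : a ≤ k) (hb : b ≤ k) {v : triFilm k} (hv : v ∈ vseg k q a b) :
    (min a b : ℤ) ≤ ((v : triFilm k) : Site 2 × Site 1).2 0 ∧ ((v : triFilm k) : Site 2 × Site 1).2 0 ≤ max a b := by
  obtain ⟨i, hi1, hi2, rfl⟩ := mem_vseg.1 hv
  rw [vx_snd (by omega)]
  constructor <;> push_cast <;> omega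

end TriFilm

end Summit.CriticalPhenomena.PercolationContinuityZ3.Theorems.Transplant

end
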